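import Summits.CriticalPhenomena.PercolationContinuityZ3.Theorems.PercNearOneGluingNoHeavyLowerTailCILOwnEdgeStability
import Summits.CriticalPhenomena.PercolationContinuityZ3.Theorems.PercNearOneGluingAdditiveGluingEdgeSwitch
import HarnessLib

/-!
# `NoHeavyLowerTail` (stmt-CriticalPhenomena-4575) — SERIES REDUCTION of a non-relay vertex of degree two

Support file (prover `prim-hp-3`, hull-port line, electrical-network technique; `--supports stmt-CriticalPhenomena-4575`).
No definitions, no named facts, no sorries.

The series law of two-terminal reliability: a non-relay vertex `z` whose only positive-weight pairs are `z–x` (weight `α`)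
and `z–y` (weight `β`) can be replaced by an extra pair `x–y` of weight `αβ`, superposed with the existing pair `x–y` (weight
`γ`): new weight `1 − (1 − γ)(1 − αβ)`.  For every vertex `a ≠ z` the law of the relay set `π(a) = {r ∈ A : a ↔ r}` is unchanged
(`z ∉ A`).

* `HullPort.series_reduction` — for every `a ≠ z` and every predicate `Q` on finite vertex sets,
  `μ_w{Q(π(a))} = μ_{w'}{Q(π(a))}`, where `w'` vanishes on the pairs at `z` (and agrees with `w` on the idle diagonal pair
  `s(z,z)`), agrees with `w` on the other pairs except
  `w' s(x,y) = 1 − (1 − w s(x,y))(1 − w s(z,x) · w s(z,y))`.  In particular `bad_w(o) = bad_{w'}(o)` (`o ≠ z`) and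
  `I_w(a) = I_{w'}(a)` for every relay `a` (`HullPort.series_reduction_bad`, `HullPort.series_reduction_lightness`).
  Proof: one-bond decompositions at `z–x` and `z–y` (`stub_oneBondDecomp_k15`); on the null-complement event that no pair at
  `z` is open, inserting one of the two pairs does not change reachability among vertices `≠ z`, and inserting both is
  inserting `x–y` (`ChampionStability.reachable_insert_iff`); gluings are read through `ChampionStability.real_update_one_eq`.
The class theorem (CIL at every observer all of whose fellow non-relays have at most two positive-weight pairs — hulls made
of Steiner paths and cycles through the ports) is in `…CILSteinerDegreeTwo.lean`.
-/

noncomputable section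

namespace Summit.CriticalPhenomena.PercolationContinuityZ3.Theorems

open MeasureTheory Set Literature.Probability.LatticeModels Literature.Probability.Percolation
open scoped Classical BigOperators

variable {n : ℕ}

namespace HullPort

open ChampionStability

/-! ### Configurations with no open pair at `z` -/

/-- If no pair at `z` is open, `z` is joined to no other vertex. [folklore] -/
theorem not_reachable_of_closed_at {ω : BondConfig (Fin n)} {z : Fin n} (hω : ∀ v, v ≠ z → s(z, v) ∉ ω)
    {a : Fin n} (haz : a ≠ z) : ¬ (openGraph ω).Reachable a z := by
  intro h
  obtain ⟨p⟩ := h.symm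
  cases p with
  | nil => exact haz rfl
  | cons hadj _ =>
    rw [openGraph_adj] at hadj
    exact hω _ (Ne.symm hadj.2) hadj.1

/-- With no open pair at `z`, inserting ONE pair `z–y` does not change reachability between vertices other than `z`
(the new pair is pendant). [folklore] -/
theorem reachable_insert_pendant_iff {ω : BondConfig (Fin n)} {z y : Fin n} (hzy : z ≠ y)
    (hω : ∀ v, v ≠ z → s(z, v) ∉ ω) {a r : Fin n} (haz : a ≠ z) (hrz : r ≠ z) :
    (openGraph (insert s(z, y) ω)).Reachable a r ↔ (openGraph ω).Reachable a r := by
  rw [reachable_insert_iff ω hzy a r]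
  constructor
  · rintro (h | ⟨⟨s₁, hs₁, h₁⟩, ⟨s₂, hs₂, h₂⟩⟩)
    · exact h
    · simp only [Finset.mem_insert, Finset.mem_singleton] at hs₁ hs₂
      rcases hs₁ with rfl | rfl
      · exact absurd h₁ (not_reachable_of_closed_at hω haz)
      · rcases hs₂ with rfl | rfl
        · exact absurd h₂.symm (not_reachable_of_closed_at hω hrz)
        · exact h₁.trans h₂
  · exact fun h => Or.inl h

/-- With no open pair at `z`, inserting BOTH pairs `z–x`, `z–y` changes reachability between vertices other than `z` exactly
as inserting the pair `x–y` does (series law, pointwise). [folklore] -/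
theorem reachable_insert_insert_iff {ω : BondConfig (Fin n)} {z x y : Fin n} (hzx : z ≠ x) (hzy : z ≠ y) (hxy : x ≠ y)
    (hω : ∀ v, v ≠ z → s(z, v) ∉ ω) {a r : Fin n} (haz : a ≠ z) (hrz : r ≠ z) :
    (openGraph (insert s(z, x) (insert s(z, y) ω))).Reachable a r ↔ (openGraph (insert s(x, y) ω)).Reachable a r := by
  have hz_iso : ∀ b, b ≠ z → ¬ (openGraph ω).Reachable b z := fun b hb => not_reachable_of_closed_at hω hb
  -- reachability after the first insertion, for the endpoints we need
  have h1 : ∀ b c, b ≠ z → c ≠ z →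
      ((openGraph (insert s(z, y) ω)).Reachable b c ↔ (openGraph ω).Reachable b c) :=
    fun b c hb hc => reachable_insert_pendant_iff hzy hω hb hc
  have h1z : ∀ b, b ≠ z → ((openGraph (insert s(z, y) ω)).Reachable b z ↔ (openGraph ω).Reachable b y) := by
    intro b hb
    rw [reachable_insert_iff ω hzy b z]
    constructor
    · rintro (h | ⟨⟨s₁, hs₁, h₁⟩, -⟩)
      · exact absurd h (hz_iso b hb)
      · simp only [Finset.mem_insert, Finset.mem_singleton] at hs₁
        rcases hs₁ with rfl | rfl
        · exact absurd h₁ (hz_iso b hb)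
        · exact h₁
    · intro h
      refine Or.inr ⟨⟨y, by simp, h⟩, ⟨z, by simp, SimpleGraph.Reachable.refl _⟩⟩
  have h1z' : ∀ c, c ≠ z → ((openGraph (insert s(z, y) ω)).Reachable z c ↔ (openGraph ω).Reachable y c) := by
    intro c hc
    rw [SimpleGraph.reachable_comm, h1z c hc, SimpleGraph.reachable_comm]
  rw [reachable_insert_iff (insert s(z, y) ω) hzx a r, reachable_insert_iff ω hxy a r, h1 a r haz hrz]
  simp only [Finset.mem_insert, Finset.mem_singleton, exists_eq_or_imp, exists_eq_left]
  rw [h1z a haz, h1 a x haz hzx.symm, h1z' r hrz, h1 x r hzx.symm hrz]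
  tauto

/-- Under weights vanishing on all pairs at `z`, almost surely no pair at `z` is open: events that agree on that set have the
same probability. [folklore] -/
theorem real_congr_of_closed_at (u : Sym2 (Fin n) → unitInterval) (z : Fin n) (hu : ∀ v, v ≠ z → u s(z, v) = 0)
    (S T : Set (BondConfig (Fin n)))
    (hST : ∀ ω : BondConfig (Fin n), (∀ v, v ≠ z → s(z, v) ∉ ω) → (ω ∈ S ↔ ω ∈ T)) :
    (prodBernoulli u).real S = (prodBernoulli u).real T := by
  set μ := prodBernoulli u with hμ
  set F : Finset (Sym2 (Fin n)) := (Finset.univ.filter fun v : Fin n => v ≠ z).image fun v => s(z, v) with hF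
  set N : Set (BondConfig (Fin n)) := {ω | ∃ e ∈ F, e ∈ ω} with hN
  have hmeas : ∀ U : Set (BondConfig (Fin n)), MeasurableSet U := fun U => (Set.toFinite U).measurableSet
  have hN0 : μ.real N = 0 := by
    apply le_antisymm _ measureReal_nonneg
    refine (prodBernoulli_real_exists_mem_le_sum u F).trans (le_of_eq ?_)
    apply Finset.sum_eq_zero
    intro e he
    obtain ⟨v, hv, rfl⟩ := Finset.mem_image.mp he
    rw [hu v (Finset.mem_filter.mp hv).2]
    rfl
  have hgood : ∀ ω : BondConfig (Fin n), ω ∉ N → ∀ v, v ≠ z → s(z, v) ∉ ω := by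
    intro ω hω v hv he
    exact hω ⟨s(z, v), Finset.mem_image.mpr ⟨v, Finset.mem_filter.mpr ⟨Finset.mem_univ _, hv⟩, rfl⟩, he⟩
  have hsplit : ∀ U : Set (BondConfig (Fin n)), μ.real U = μ.real (U \ N) := by
    intro U
    have h := measureReal_inter_add_sdiff (μ := μ) (s := U) (hmeas N) (measure_ne_top _ _)
    have h0 : μ.real (U ∩ N) = 0 :=
      le_antisymm ((measureReal_mono inter_subset_right (measure_ne_top _ _)).trans hN0.le) measureReal_nonneg
    linarith
  have hdiff : S \ N = T \ N := by
    ext ω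
    simp only [mem_sdiff]
    constructor
    · rintro ⟨hS, hω⟩; exact ⟨(hST ω (hgood ω hω)).1 hS, hω⟩
    · rintro ⟨hT, hω⟩; exact ⟨(hST ω (hgood ω hω)).2 hT, hω⟩
  rw [hsplit S, hsplit T, hdiff]

/-! ### The series law for the law of a relay set -/

/-- Gluing a pair of positive weight: `μ_u(insert e ⁻¹' E) = μ_{u[e ↦ 1]}(E)` without assuming `u e = 0`
(one-bond decomposition at `e`; on `{e open}` the insertion is the identity). [folklore] -/
theorem real_preimage_insert_eq_update_one (u : Sym2 (Fin n) → unitInterval) (x y : Fin n)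
    (E : Set (BondConfig (Fin n))) :
    (prodBernoulli u).real ((fun ω : BondConfig (Fin n) => insert s(x, y) ω) ⁻¹' E) =
      (prodBernoulli (Function.update u s(x, y) 1)).real E := by
  set e : Sym2 (Fin n) := s(x, y) with he
  set u₀ := Function.update u e 0 with hu₀
  have hu₀e : u₀ e = 0 := by simp [hu₀]
  have h1 : Function.update u e 1 = Function.update u₀ e 1 := by rw [hu₀, Function.update_idem]
  rw [stub_oneBondDecomp_k15 n u e, ← hu₀, h1]
  -- the `e ↦ 0` part: `real_update_one_eq`
  have hu₀e' : u₀ s(x, y) = 0 := by rw [← he]; exact hu₀e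
  rw [he, ← real_update_one_eq u₀ hu₀e' E, ← he]
  -- the `e ↦ 1` part: insertion is a.s. the identity
  have h2 : (prodBernoulli (Function.update u₀ e 1)).real ((fun ω : BondConfig (Fin n) => insert e ω) ⁻¹' E) =
      (prodBernoulli (Function.update u₀ e 1)).real E := by
    apply edgeSw_real_eq_of_sure (Function.update u₀ e 1) e (by simp)
    intro ω he
    simp only [mem_preimage, Set.insert_eq_of_mem he]
  rw [h2]
  ring

/-- **Series reduction.**  Let `z ∉ A` have positive-weight pairs only to `x` and `y` (`x, y, z` distinct), and let `w'`
vanish on the pairs at `z`, agree with `w` on all other pairs except `s(x,y)`, where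
`w' s(x,y) = 1 − (1 − w s(x,y))·(1 − w s(z,x)·w s(z,y))`.  Then for every vertex `a ≠ z` and every predicate `Q` on finite
vertex sets, `μ_w{Q({r ∈ A : a ↔ r})} = μ_{w'}{Q({r ∈ A : a ↔ r})}`: the law of the relay set of `a` is unchanged.
[folklore — the series law of network reliability] -/
theorem series_reduction (w w' : Sym2 (Fin n) → unitInterval) (A : Finset (Fin n)) (z x y : Fin n)
    (hzA : z ∉ A) (hzx : z ≠ x) (hzy : z ≠ y) (hxy : x ≠ y)
    (hz : ∀ v, v ≠ z → v ≠ x → v ≠ y → w s(z, v) = 0)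
    (hw'z : ∀ v, v ≠ z → w' s(z, v) = 0) (hw'zz : w' s(z, z) = w s(z, z))
    (hw'off : ∀ e : Sym2 (Fin n), z ∉ e → e ≠ s(x, y) → w' e = w e)
    (hw'xy : (w' s(x, y) : ℝ) = 1 - (1 - w s(x, y)) * (1 - w s(z, x) * w s(z, y)))
    (a : Fin n) (haz : a ≠ z) (Q : Finset (Fin n) → Prop) :
    (prodBernoulli w).real {ω : BondConfig (Fin n) | Q (A.filter fun r => ω ∈ openConn a r)} =
      (prodBernoulli w').real {ω : BondConfig (Fin n) | Q (A.filter fun r => ω ∈ openConn a r)} := by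
  set E := {ω : BondConfig (Fin n) | Q (A.filter fun r => ω ∈ openConn a r)} with hE
  set ex : Sym2 (Fin n) := s(z, x) with hex
  set ey : Sym2 (Fin n) := s(z, y) with hey
  set exy : Sym2 (Fin n) := s(x, y) with hexy
  have hexey : ex ≠ ey := by
    rw [hex, hey]; intro h
    rw [Sym2.eq_iff] at h
    rcases h with ⟨-, h⟩ | ⟨h, -⟩
    · exact hxy h
    · exact hzy h
  have hzexy : z ∉ exy := by
    rw [hexy, Sym2.mem_iff, not_or]; exact ⟨hzx, hzy⟩
  -- the reduced base: all pairs at `z` switched off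
  set u : Sym2 (Fin n) → unitInterval := Function.update (Function.update w ex 0) ey 0 with hu
  have huz : ∀ v, v ≠ z → u s(z, v) = 0 := by
    intro v hv
    by_cases hvy : v = y
    · subst hvy; simp [hu, hey]
    by_cases hvx : v = x
    · subst hvx
      rw [hu, Function.update_of_ne (by rw [← hex]; exact hexey), ← hex]
      simp
    · rw [hu, Function.update_of_ne, Function.update_of_ne]
      · exact hz v hv hvx hvy
      · rw [hex]; intro h; rw [Sym2.eq_iff] at h
        rcases h with ⟨-, h⟩ | ⟨-, h⟩
        · exact hvx h
        · exact hv h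
      · rw [hey]; intro h; rw [Sym2.eq_iff] at h
        rcases h with ⟨-, h⟩ | ⟨-, h⟩
        · exact hvy h
        · exact hv h
  -- relay sets of `a` under the various insertions, on configurations closed at `z`
  have hfilt_y : ∀ ω : BondConfig (Fin n), (∀ v, v ≠ z → s(z, v) ∉ ω) →
      (A.filter fun r => insert ey ω ∈ openConn a r) = (A.filter fun r => ω ∈ openConn a r) := by
    intro ω hω
    apply Finset.filter_congr
    intro r hr
    have hrz : r ≠ z := fun h => hzA (h ▸ hr)
    exact reachable_insert_pendant_iff hzy hω haz hrz
  have hfilt_x : ∀ ω : BondConfig (Fin n), (∀ v, v ≠ z → s(z, v) ∉ ω) →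
      (A.filter fun r => insert ex ω ∈ openConn a r) = (A.filter fun r => ω ∈ openConn a r) := by
    intro ω hω
    apply Finset.filter_congr
    intro r hr
    have hrz : r ≠ z := fun h => hzA (h ▸ hr)
    exact reachable_insert_pendant_iff hzx hω haz hrz
  have hfilt_xy : ∀ ω : BondConfig (Fin n), (∀ v, v ≠ z → s(z, v) ∉ ω) →
      (A.filter fun r => insert ex (insert ey ω) ∈ openConn a r) = (A.filter fun r => insert exy ω ∈ openConn a r) := by
    intro ω hω
    apply Finset.filter_congr
    intro r hr
    have hrz : r ≠ z := fun h => hzA (h ▸ hr)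
    exact reachable_insert_insert_iff hzx hzy hxy hω haz hrz
  -- (a) pendant insertions are invisible
  have hpy : (prodBernoulli u).real ((fun ω : BondConfig (Fin n) => insert ey ω) ⁻¹' E) = (prodBernoulli u).real E :=
    real_congr_of_closed_at u z huz _ _ fun ω hω => by
      simp only [mem_preimage, hE, mem_setOf_eq, hfilt_y ω hω]
  have hpx : (prodBernoulli u).real ((fun ω : BondConfig (Fin n) => insert ex ω) ⁻¹' E) = (prodBernoulli u).real E :=
    real_congr_of_closed_at u z huz _ _ fun ω hω => by
      simp only [mem_preimage, hE, mem_setOf_eq, hfilt_x ω hω]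
  -- (b) the double insertion is the insertion of `x–y`
  have hpxy : (prodBernoulli u).real ((fun ω : BondConfig (Fin n) => insert ey ω) ⁻¹'
        ((fun ω : BondConfig (Fin n) => insert ex ω) ⁻¹' E)) =
      (prodBernoulli u).real ((fun ω : BondConfig (Fin n) => insert exy ω) ⁻¹' E) :=
    real_congr_of_closed_at u z huz _ _ fun ω hω => by
      simp only [mem_preimage, hE, mem_setOf_eq, hfilt_xy ω hω]
  -- the four corner measures in terms of `u`
  have hue_x : u ex = 0 := by
    have := huz x hzx.symm; rwa [← hex] at this
  have hue_y : u ey = 0 := by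
    have := huz y hzy.symm; rwa [← hey] at this
  set m : ℝ := (prodBernoulli u).real E with hm
  set m' : ℝ := (prodBernoulli (Function.update u exy 1)).real E with hm'
  have h01 : (prodBernoulli (Function.update u ey 1)).real E = m := by
    rw [hey, real_update_one_eq u (by rw [← hey]; exact hue_y) E, ← hey, hpy]
  have h10 : (prodBernoulli (Function.update u ex 1)).real E = m := by
    rw [hex, real_update_one_eq u (by rw [← hex]; exact hue_x) E, ← hex, hpx]
  have h11 : (prodBernoulli (Function.update (Function.update u ey 1) ex 1)).real E = m' := by
    have hue_x' : Function.update u ey 1 ex = 0 := by rw [Function.update_of_ne hexey]; exact hue_x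
    have hA : (prodBernoulli (Function.update (Function.update u ey 1) ex 1)).real E =
        (prodBernoulli (Function.update u ey 1)).real ((fun ω : BondConfig (Fin n) => insert ex ω) ⁻¹' E) := by
      rw [hex]; exact real_update_one_eq (Function.update u ey 1) (by rw [← hex]; exact hue_x') E
    have hB : (prodBernoulli (Function.update u ey 1)).real ((fun ω : BondConfig (Fin n) => insert ex ω) ⁻¹' E) =
        (prodBernoulli u).real ((fun ω : BondConfig (Fin n) => insert ey ω) ⁻¹'
          ((fun ω : BondConfig (Fin n) => insert ex ω) ⁻¹' E)) := by
      rw [hey]; exact real_update_one_eq u (by rw [← hey]; exact hue_y) _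
    rw [hA, hB, hpxy, hm', hexy, real_preimage_insert_eq_update_one]
  -- one-bond decompositions of `μ_w(E)` at `ex` then `ey`
  set α : ℝ := (w ex : ℝ) with hα
  set β : ℝ := (w ey : ℝ) with hβ
  set γ : ℝ := (w exy : ℝ) with hγ
  have hw_ex0 : Function.update w ex 0 = Function.update u ey (w ey) := by
    rw [hu, Function.update_idem]
    have h : Function.update w ex 0 ey = w ey := Function.update_of_ne hexey.symm _ _
    conv_rhs => rw [← h]
    rw [Function.update_eq_self]
  have hw_ex1 : Function.update w ex 1 = Function.update (Function.update u ey (w ey)) ex 1 := by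
    rw [← hw_ex0, Function.update_idem]
  have hdec : (prodBernoulli w).real E = (1 - α * β) * m + α * β * m' := by
    rw [stub_oneBondDecomp_k15 n w ex E, hw_ex0, hw_ex1]
    -- second coordinate
    have hA0 := stub_oneBondDecomp_k15 n (Function.update u ey (w ey)) ey E
    have hA1 := stub_oneBondDecomp_k15 n (Function.update (Function.update u ey (w ey)) ex 1) ey E
    simp only [Function.update_self, Function.update_idem] at hA0
    rw [Function.update_of_ne hexey.symm, Function.update_self] at hA1
    have e1 : Function.update (Function.update (Function.update u ey (w ey)) ex 1) ey 0 = Function.update u ex 1 := by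
      rw [Function.update_comm hexey.symm, Function.update_idem]
      apply Function.update_eq_self_iff.mpr
      rw [Function.update_of_ne hexey.symm]; exact hue_y.symm
    have e2 : Function.update (Function.update (Function.update u ey (w ey)) ex 1) ey 1 =
        Function.update (Function.update u ey 1) ex 1 := by
      rw [Function.update_comm hexey.symm, Function.update_idem, Function.update_comm hexey]
    have e3 : Function.update u ey 0 = u := Function.update_eq_self_iff.mpr hue_y.symm
    rw [e1, e2] at hA1
    rw [e3] at hA0
    rw [hA0, hA1, h01, h10, h11, ← hα, ← hβ, ← hm]
    ring
  -- decomposition of `m` at `exy`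
  have huexy : (u exy : ℝ) = γ := by
    rw [hu, Function.update_of_ne, Function.update_of_ne]
    · intro h; exact hzexy (h ▸ (by rw [hex]; exact Sym2.mem_mk_left z x))
    · intro h; exact hzexy (h ▸ (by rw [hey]; exact Sym2.mem_mk_left z y))
  set m₀ : ℝ := (prodBernoulli (Function.update u exy 0)).real E with hm₀
  have hmdec : m = (1 - γ) * m₀ + γ * m' := by
    rw [hm, stub_oneBondDecomp_k15 n u exy E, huexy]
  -- decomposition of `μ_{w'}(E)` at `exy`
  have hw'0 : Function.update w' exy 0 = Function.update u exy 0 := by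
    funext e
    by_cases he : e = exy
    · subst he; simp
    · rw [Function.update_of_ne he, Function.update_of_ne he]
      by_cases hze : z ∈ e
      · obtain ⟨v, rfl⟩ := Sym2.mem_iff_exists.mp hze
        by_cases hvz : v = z
        · subst hvz
          -- the idle diagonal pair `s(z,z)`
          rw [hw'zz, hu, Function.update_of_ne, Function.update_of_ne]
          · rw [hex]; intro h; rw [Sym2.eq_iff] at h
            rcases h with ⟨-, h⟩ | ⟨h, -⟩
            · exact hzx h
            · exact hzx h
          · rw [hey]; intro h; rw [Sym2.eq_iff] at h
            rcases h with ⟨-, h⟩ | ⟨h, -⟩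
            · exact hzy h
            · exact hzy h
        · rw [hw'z v hvz, huz v hvz]
      · rw [hw'off e hze he, hu, Function.update_of_ne, Function.update_of_ne]
        · intro h; exact hze (h ▸ (by rw [hex]; exact Sym2.mem_mk_left z x))
        · intro h; exact hze (h ▸ (by rw [hey]; exact Sym2.mem_mk_left z y))
  have hw'1 : Function.update w' exy 1 = Function.update u exy 1 := by
    have h := congrArg (fun f => Function.update f exy (1 : unitInterval)) hw'0
    simpa only [Function.update_idem] using h
  have hw'xy' : (w' exy : ℝ) = 1 - (1 - γ) * (1 - α * β) := by
    rw [hα, hβ, hγ, hexy, hex, hey]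
    exact hw'xy
  have hdec' : (prodBernoulli w').real E = (1 - (1 - γ) * (1 - α * β)) * m' + (1 - γ) * (1 - α * β) * m₀ := by
    rw [stub_oneBondDecomp_k15 n w' exy E, hw'0, hw'1, ← hm₀, ← hm', hw'xy']
    ring
  rw [hdec, hmdec, hdec']
  ring

end HullPort

end Summit.CriticalPhenomena.PercolationContinuityZ3.Theorems

end
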